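import Summits.AtomisticToContinuum.HydrodynamicLimit.Theorems.AnnealedZeroHorizonDefs
import Summits.AtomisticToContinuum.HydrodynamicLimit.Theorems.BoxDissipativeWeakStrongLocalGibbsFineScaleStaticsPrelim
import Literature.MathematicalPhysics.KineticTheory.HardSphereEulerProofs
import Literature.Analysis.FluidPDE.HardSpherePhaseSpaceProofs

/-!
# Route `AnnealedZeroHorizon`, crux line `AnnealedWeakStrong`: stub S3c `stub_fieldsCloseTendsto`

Item stmt-AtomisticToContinuum-9258 (crux `AnnealedZeroHorizon.AnnealedWeakStrong`), line `registered`,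
registered stub `stub_fieldsCloseTendsto` (S3c): if the `k`-mollified empirical fields at time `t` are
close in mean (`L¹(P_N ⊗ dx)`, observable `AWS.fieldDistObs`) to the conserved state of continuous
macroscopic fields along SOME admissible kernels of arbitrarily small radius
(`AWS.FieldsCloseViaKernelsAt`), then the tested empirical density / momentum / energy fields converge
in probability (`TendstoHydroFieldsAt`); valid for every `σ`, profile, flow family and law. Pathwise,
for a weighted empirical average `A(χ) = (N+1)⁻¹ ∑ χ(xᵢ) aᵢ` (`aᵢ = 1, vᵢ, ‖vᵢ‖²/2`): mollifier
transfer `A(χ^k) = ∫ χ(x) A(k(x − ·)) dx`, `χ^k(y) = ∫ k(x − y) χ(x) dx`; `|χ − χ^k| ≤ ω` once `χ`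
varies by `≤ ω` on the support of `k(· − y)` (mass one by translation invariance, `‖x − y‖ ≤ euclidDist`,
uniform continuity of `χ`); velocity moments via `‖v‖ ≤ 1/2 + ‖v‖²/2` and
`(N+1)⁻¹∑‖vᵢ‖²/2 = ∫ E^k ≤ |∫ Ē| + D`, `D = fieldDistObs`; so each deviation is
`≤ ω(1 + C_E + D) + ‖χ‖_∞ D`, each deviation event lies in `{D ≥ c(δ, χ)}`, and Markov (`D` measurable:
finite sums, `integral_prod_right'`, measurable flow) bounds its probability by `E[D]/c`.
-/

noncomputable section

open MeasureTheory Filter Set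
open scoped ENNReal Topology

namespace Summit.AtomisticToContinuum.HydrodynamicLimit.Theorems.AWS

open Literature.MathematicalPhysics.KineticTheory Literature.Analysis.FluidPDE

/-- **S3c — fields close in mean along some kernels of vanishing radius ⇒ convergence in probability of the
tested fields (size M).** For ANY `σ`, profiles, flow family, fields with continuous time-`t` slices and time `t`:
`FieldsCloseViaKernelsAt` at `t` implies `TendstoHydroFieldsAt` at `t`. Pathwise: `⟨ρ_N, χ⟩ = ⟨ρ_N, χ − χ^k⟩ +
∫ χ ρ^k dx` with `χ^k(y) = ∫ χ(x) k(x − y) dx`, `|χ − χ^k| ≤ ω_χ(√3 ℓ)` (mass one, support in the `ℓ`-ball,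
`‖x − y‖ ≤ euclidDist`), `⟨ρ_N, 1⟩ = 1`; momentum and energy the same with `(N+1)⁻¹Σ‖vᵢ‖ ≤ 1 + ⟨E_N, 1⟩` and
`⟨E_N, 1⟩ = ∫ E^k dx ≤ ∫ Ē + fieldDistObs`; then Markov on `fieldDistObs` (measurable: continuous kernel,
measurable flow). No property of the law or of `σ` is used. -/
def Sig.stub_fieldsCloseTendsto : Prop :=
  ∀ (σ : ℝ) (a₀ θ₀ : T3 → ℝ) (u₀ : T3 → V3)
    (Φ : (N : ℕ) → HardSphereFlow (Literature.Analysis.FluidPDE.Torus.geometry (Fin 3)) (hsDiameter σ N) (N + 1))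
    (ρ θ : ℝ → T3 → ℝ) (u : ℝ → T3 → V3) (t : ℝ),
    Continuous (ρ t) → Continuous (u t) → Continuous (θ t) →
      FieldsCloseViaKernelsAt σ a₀ u₀ θ₀ Φ ρ u θ t →
        TendstoHydroFieldsAt (fun N => localGibbsLaw σ a₀ u₀ θ₀ N (Φ N)) Φ ρ u θ t

namespace FieldsCloseTendsto

variable {N : ℕ} {G : Type*} [NormedAddCommGroup G] [NormedSpace ℝ G]

/-! ### Weighted empirical averages `(N+1)⁻¹ ∑ χ(xᵢ) • aᵢ` -/

/-- Two `ω`-close test functions give `ω (N+1)⁻¹∑‖aᵢ‖`-close weighted averages. -/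
theorem norm_wavg_sub_le (z : Config (N + 1) (Fin 3) T3) (a : Fin (N + 1) → G) {χ₁ χ₂ : T3 → ℝ}
    {ω : ℝ} (h : ∀ y, |χ₁ y - χ₂ y| ≤ ω) :
    ‖(((N + 1 : ℕ) : ℝ)⁻¹ • ∑ i, χ₁ (z i).1 • a i) - ((N + 1 : ℕ) : ℝ)⁻¹ • ∑ i, χ₂ (z i).1 • a i‖ ≤
      ω * ((((N + 1 : ℕ) : ℝ))⁻¹ * ∑ i, ‖a i‖) := by
  rw [← smul_sub, ← Finset.sum_sub_distrib, norm_smul, Real.norm_eq_abs,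
    abs_of_nonneg (by positivity : (0 : ℝ) ≤ ((N + 1 : ℕ) : ℝ)⁻¹), mul_left_comm, Finset.mul_sum]
  refine mul_le_mul_of_nonneg_left ((norm_sum_le _ _).trans (Finset.sum_le_sum fun i _ => ?_))
    (by positivity)
  rw [← sub_smul, norm_smul, Real.norm_eq_abs]
  exact mul_le_mul_of_nonneg_right (h _) (norm_nonneg _)

/-- **Mollifier transfer**: `(N+1)⁻¹ ∑ χ^k(xᵢ) aᵢ = ∫ χ(x) ((N+1)⁻¹ ∑ k(x − xᵢ) aᵢ) dx`,
`χ^k(y) = ∫ k(x − y) χ(x) dx` (finite sums against integrals of continuous functions on `𝕋³`). -/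
theorem wavg_mollify_eq [CompleteSpace G] (z : Config (N + 1) (Fin 3) T3) (a : Fin (N + 1) → G)
    {χ k : T3 → ℝ} (hχ : Continuous χ) (hk : Continuous k) :
    ((N + 1 : ℕ) : ℝ)⁻¹ • ∑ i, (∫ x, k (x - (z i).1) * χ x) • a i =
      ∫ x, χ x • (((N + 1 : ℕ) : ℝ)⁻¹ • ∑ i, k (x - (z i).1) • a i) := by
  have hi : ∀ i ∈ Finset.univ, Integrable (fun x => (k (x - (z i).1) * χ x) • a i) := fun i _ =>
    integrable_of_continuous_T3
      (((hk.comp (continuous_id.sub continuous_const)).mul hχ).smul continuous_const)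
  symm
  calc ∫ x, χ x • (((N + 1 : ℕ) : ℝ)⁻¹ • ∑ i, k (x - (z i).1) • a i)
      = ∫ x, ((N + 1 : ℕ) : ℝ)⁻¹ • ∑ i, (k (x - (z i).1) * χ x) • a i := by
        refine integral_congr_ae (ae_of_all _ fun x => ?_)
        dsimp only
        rw [smul_comm, Finset.smul_sum]
        congr 1
        exact Finset.sum_congr rfl fun i _ => by rw [smul_smul, mul_comm]
    _ = ((N + 1 : ℕ) : ℝ)⁻¹ • ∑ i, ∫ x, (k (x - (z i).1) * χ x) • a i := by
        rw [integral_smul, integral_finsetSum _ hi]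
    _ = ((N + 1 : ℕ) : ℝ)⁻¹ • ∑ i, (∫ x, k (x - (z i).1) * χ x) • a i := by
        congr 1
        exact Finset.sum_congr rfl fun i _ => integral_smul_const _ _

/-- `‖a − ∫ χ • g‖ ≤ ‖a − a'‖ + ‖χ‖_∞ ∫ ‖A' − g‖` whenever `a' = ∫ χ • A'` (continuous data on `𝕋³`). -/
theorem norm_sub_integral_smul_le {a a' : G} {A' g : T3 → G} {χ : T3 → ℝ} {C : ℝ}
    (hχ : Continuous χ) (hC : ∀ x, |χ x| ≤ C) (hA' : Continuous A') (hg : Continuous g)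
    (htrans : a' = ∫ x, χ x • A' x) :
    ‖a - ∫ x, χ x • g x‖ ≤ ‖a - a'‖ + C * ∫ x, ‖A' x - g x‖ := by
  have hi1 : Integrable (fun x => χ x • A' x) := integrable_of_continuous_T3 (hχ.smul hA')
  have hi2 : Integrable (fun x => χ x • g x) := integrable_of_continuous_T3 (hχ.smul hg)
  have h3 : a' - ∫ x, χ x • g x = ∫ x, χ x • (A' x - g x) := by
    rw [htrans, ← integral_sub hi1 hi2]
    exact integral_congr_ae (ae_of_all _ fun x => (smul_sub _ _ _).symm)
  have h4 : ‖∫ x, χ x • (A' x - g x)‖ ≤ C * ∫ x, ‖A' x - g x‖ :=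
    calc ‖∫ x, χ x • (A' x - g x)‖ ≤ ∫ x, ‖χ x • (A' x - g x)‖ := norm_integral_le_integral_norm _
      _ ≤ ∫ x, C * ‖A' x - g x‖ := by
          refine integral_mono (integrable_of_continuous_T3 (hχ.smul (hA'.sub hg)).norm)
            (integrable_of_continuous_T3 (continuous_const.mul (hA'.sub hg).norm)) fun x => ?_
          dsimp only
          rw [norm_smul, Real.norm_eq_abs]
          exact mul_le_mul_of_nonneg_right (hC x) (norm_nonneg _)
      _ = C * ∫ x, ‖A' x - g x‖ := integral_const_mul _ _
  calc ‖a - ∫ x, χ x • g x‖ = ‖(a - a') + (a' - ∫ x, χ x • g x)‖ := by congr 1; abel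
    _ ≤ ‖a - a'‖ + ‖a' - ∫ x, χ x • g x‖ := norm_add_le _ _
    _ ≤ ‖a - a'‖ + C * ∫ x, ‖A' x - g x‖ := by rw [h3]; exact add_le_add le_rfl h4

/-- **Pathwise deviation bound for a weighted empirical field `A(χ) = (N+1)⁻¹ ∑ χ(xᵢ) aᵢ`.** If
`|χ| ≤ C`, `k ≥ 0` is a continuous kernel of mass one with `k(x − y) ≠ 0 → dist x y < ℓ₀`, and
`χ` varies by `≤ ω` at sup-distance `< ℓ₀`, then for every continuous target `g`,
`‖A(χ) − ∫ χ • g‖ ≤ ω (N+1)⁻¹∑‖aᵢ‖ + C ∫ ‖A(k(x − ·)) − g(x)‖ dx`. -/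
theorem norm_field_dev_le [CompleteSpace G] (z : Config (N + 1) (Fin 3) T3) {A : (T3 → ℝ) → G}
    {a : Fin (N + 1) → G} (hA : ∀ χ, A χ = ((N + 1 : ℕ) : ℝ)⁻¹ • ∑ i, χ (z i).1 • a i)
    {χ k : T3 → ℝ} {g : T3 → G}
    {ω C ℓ₀ : ℝ} (hχ : Continuous χ) (hC : ∀ x, |χ x| ≤ C) (hk : Continuous k)
    (hk0 : ∀ y, 0 ≤ k y) (hk1 : ∫ y, k y = 1) (hsupp : ∀ x y, k (x - y) ≠ 0 → dist x y < ℓ₀)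
    (hmod : ∀ x y, dist x y < ℓ₀ → |χ x - χ y| ≤ ω) (hg : Continuous g) :
    ‖A χ - ∫ x, χ x • g x‖ ≤
      ω * (((N + 1 : ℕ) : ℝ)⁻¹ * ∑ i, ‖a i‖) + C * ∫ x, ‖A (fun y => k (x - y)) - g x‖ := by
  set χk : T3 → ℝ := fun y => ∫ x, k (x - y) * χ x with hχk
  obtain ⟨Ck, -, hkC⟩ := exists_forall_abs_le_of_continuous hk
  have hclose : ∀ y, |χ y - χk y| ≤ ω := fun y => by
    rw [abs_sub_comm]
    exact LGFS.abs_integral_kernel_mul_sub_le (g := fun x => k (x - y))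
      (hk.comp (continuous_id.sub continuous_const)).measurable (fun x => hk0 _)
      (fun x => (le_abs_self _).trans (hkC _))
      ((integral_sub_right_eq_self k y).trans hk1) (fun x hx => hsupp x y hx) hχ.measurable hC
      fun x hx => hmod x y hx
  have h1 : ‖A χ - A χk‖ ≤ ω * (((N + 1 : ℕ) : ℝ)⁻¹ * ∑ i, ‖a i‖) := by
    rw [hA, hA]; exact norm_wavg_sub_le z a hclose
  have h2 : A χk = ∫ x, χ x • A (fun y => k (x - y)) := by
    simp_rw [hA]; exact wavg_mollify_eq z a hχ hk
  have hA'c : Continuous fun x => A (fun y => k (x - y)) := by simp_rw [hA]; fun_prop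
  exact (norm_sub_integral_smul_le hχ hC hA'c hg h2).trans (add_le_add h1 le_rfl)

/-! ### The field distance controls the components and the kinetic energy -/

section Deviations

variable (z : Config (N + 1) (Fin 3) T3) {χ k r ϑ : T3 → ℝ} {w : T3 → V3} {ω C ℓ₀ : ℝ}

/-- The macroscopic total energy density is continuous. -/
theorem continuous_totalEnergy (hr : Continuous r) (hw : Continuous w) (hϑ : Continuous ϑ) :
    Continuous fun x => totalEnergyDensity (r x) (w x) (ϑ x) := by
  unfold totalEnergyDensity; fun_prop

/-- The three components of the field distance `D = ∫ stateDist(U^k, Ū)` are bounded by `D`. -/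
theorem integral_comp_le (hk : Continuous k) (hr : Continuous r) (hw : Continuous w) (hϑ : Continuous ϑ) :
    (∫ x, ‖empiricalDensityField z (fun y => k (x - y)) - r x‖ ≤
        ∫ x, stateDist (mollState k z x) (consState (r x) (w x) (ϑ x))) ∧
      (∫ x, ‖empiricalMomentumField z (fun y => k (x - y)) - r x • w x‖ ≤
        ∫ x, stateDist (mollState k z x) (consState (r x) (w x) (ϑ x))) ∧
      (∫ x, ‖empiricalEnergyField z (fun y => k (x - y)) - totalEnergyDensity (r x) (w x) (ϑ x)‖ ≤
        ∫ x, stateDist (mollState k z x) (consState (r x) (w x) (ϑ x))) := by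
  have h1 : Continuous fun x => empiricalDensityField z (fun y => k (x - y)) := by
    simp_rw [empiricalDensityField_eq_sum]; fun_prop
  have h2 : Continuous fun x => empiricalMomentumField z (fun y => k (x - y)) := by
    simp_rw [empiricalMomentumField_eq_sum]; fun_prop
  have h3 : Continuous fun x => empiricalEnergyField z (fun y => k (x - y)) := by
    simp_rw [empiricalEnergyField_eq_sum]; fun_prop
  have hE := continuous_totalEnergy hr hw hϑ
  have hD : Integrable fun x => stateDist (mollState k z x) (consState (r x) (w x) (ϑ x)) := by
    refine integrable_of_continuous_T3 ?_
    simp only [stateDist, mollState_fst, mollState_snd_fst, mollState_snd_snd, consState_fst,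
      consState_snd_fst, consState_snd_snd]
    exact ((h1.sub hr).abs.add ((h2.sub (hr.smul hw)).norm)).add (h3.sub hE).abs
  refine ⟨integral_mono (integrable_of_continuous_T3 (h1.sub hr).norm) hD fun x => ?_,
    integral_mono (integrable_of_continuous_T3 (h2.sub (hr.smul hw)).norm) hD fun x => ?_,
    integral_mono (integrable_of_continuous_T3 (h3.sub hE).norm) hD fun x => ?_⟩
  all_goals
    simp only [stateDist, mollState_fst, mollState_snd_fst, mollState_snd_snd, consState_fst,
      consState_snd_fst, consState_snd_snd, Real.norm_eq_abs]
  · exact le_add_of_le_of_nonneg (le_add_of_nonneg_right (norm_nonneg _)) (abs_nonneg _)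
  · exact le_add_of_le_of_nonneg (le_add_of_nonneg_left (abs_nonneg _)) (abs_nonneg _)
  · exact le_add_of_nonneg_left (add_nonneg (abs_nonneg _) (norm_nonneg _))

/-- **Kinetic energy**: `(N+1)⁻¹ ∑ ‖vᵢ‖²/2 = ∫ E^k dx ≤ |∫ Ē| + D` for a kernel of mass one. -/
theorem kinetic_le (hk : Continuous k) (hk1 : ∫ y, k y = 1) (hr : Continuous r) (hw : Continuous w)
    (hϑ : Continuous ϑ) :
    ((N + 1 : ℕ) : ℝ)⁻¹ * ∑ i, ‖(z i).2‖ ^ 2 / 2 ≤ |∫ x, totalEnergyDensity (r x) (w x) (ϑ x)| +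
      ∫ x, stateDist (mollState k z x) (consState (r x) (w x) (ϑ x)) := by
  set Ek : T3 → ℝ := fun x => empiricalEnergyField z (fun y => k (x - y)) with hEk
  set Et : T3 → ℝ := fun x => totalEnergyDensity (r x) (w x) (ϑ x) with hEt
  have hEkc : Continuous Ek := by rw [hEk]; simp_rw [empiricalEnergyField_eq_sum]; fun_prop
  have hEtc : Continuous Et := continuous_totalEnergy hr hw hϑ
  have hV : ((N + 1 : ℕ) : ℝ)⁻¹ * ∑ i, ‖(z i).2‖ ^ 2 / 2 = ∫ x, Ek x := by
    have h := wavg_mollify_eq z (fun i => ‖(z i).2‖ ^ 2 / 2) (χ := fun _ => (1 : ℝ)) continuous_const hk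
    simp only [mul_one, one_smul, integral_sub_right_eq_self k, hk1] at h
    rw [hEk]; simp_rw [empiricalEnergyField_eq_sum]
    simpa only [smul_eq_mul] using h
  have hiD : Integrable fun x => Ek x - Et x := integrable_of_continuous_T3 (hEkc.sub hEtc)
  rw [hV]
  calc ∫ x, Ek x = ∫ x, (Et x + (Ek x - Et x)) := integral_congr_ae (ae_of_all _ fun x => by ring)
    _ = (∫ x, Et x) + ∫ x, (Ek x - Et x) := integral_add (integrable_of_continuous_T3 hEtc) hiD
    _ ≤ |∫ x, Et x| + ∫ x, stateDist (mollState k z x) (consState (r x) (w x) (ϑ x)) :=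
        add_le_add (le_abs_self _) ((le_abs_self _).trans
          (abs_integral_le_integral_abs.trans (integral_comp_le z hk hr hw hϑ).2.2))

/-! ### The three pathwise deviation bounds -/

/-- **Density**: `|⟨ρ_N, χ⟩ − ∫ χ ρ| ≤ ω + ‖χ‖_∞ D`. -/
theorem abs_density_dev_le (hχ : Continuous χ) (hC0 : 0 ≤ C) (hC : ∀ x, |χ x| ≤ C) (hk : Continuous k)
    (hk0 : ∀ y, 0 ≤ k y) (hk1 : ∫ y, k y = 1) (hsupp : ∀ x y, k (x - y) ≠ 0 → dist x y < ℓ₀)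
    (hmod : ∀ x y, dist x y < ℓ₀ → |χ x - χ y| ≤ ω) (hr : Continuous r) (hw : Continuous w)
    (hϑ : Continuous ϑ) :
    |empiricalDensityField z χ - ∫ x, χ x * r x| ≤
      ω + C * ∫ x, stateDist (mollState k z x) (consState (r x) (w x) (ϑ x)) := by
  have h := norm_field_dev_le z (A := fun χ => empiricalDensityField z χ) (a := fun _ => (1 : ℝ))
    (fun χ => by simp only [empiricalDensityField_eq_sum, smul_eq_mul, mul_one])
    hχ hC hk hk0 hk1 hsupp hmod hr
  have h1 : ((N + 1 : ℕ) : ℝ)⁻¹ * ∑ _i : Fin (N + 1), ‖(1 : ℝ)‖ = 1 := by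
    rw [Finset.sum_const, Finset.card_univ, Fintype.card_fin, norm_one, nsmul_eq_mul, mul_one,
      inv_mul_cancel₀ (by positivity)]
  rw [h1, mul_one] at h
  exact h.trans (add_le_add le_rfl (mul_le_mul_of_nonneg_left (integral_comp_le z hk hr hw hϑ).1 hC0))

/-- **Momentum**: `‖⟨m_N, χ⟩ − ∫ (χρ) • u‖ ≤ ω (1/2 + |∫ Ē| + D) + ‖χ‖_∞ D`. -/
theorem norm_momentum_dev_le (hχ : Continuous χ) (hC0 : 0 ≤ C) (hC : ∀ x, |χ x| ≤ C)
    (hk : Continuous k) (hk0 : ∀ y, 0 ≤ k y) (hk1 : ∫ y, k y = 1)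
    (hsupp : ∀ x y, k (x - y) ≠ 0 → dist x y < ℓ₀) (hω0 : 0 ≤ ω)
    (hmod : ∀ x y, dist x y < ℓ₀ → |χ x - χ y| ≤ ω) (hr : Continuous r) (hw : Continuous w)
    (hϑ : Continuous ϑ) :
    ‖empiricalMomentumField z χ - ∫ x, (χ x * r x) • w x‖ ≤
      ω * (1 / 2 + |∫ x, totalEnergyDensity (r x) (w x) (ϑ x)| +
          ∫ x, stateDist (mollState k z x) (consState (r x) (w x) (ϑ x))) +
        C * ∫ x, stateDist (mollState k z x) (consState (r x) (w x) (ϑ x)) := by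
  have h := norm_field_dev_le z (A := fun χ => empiricalMomentumField z χ) (a := fun i => (z i).2)
    (fun χ => empiricalMomentumField_eq_sum z χ) hχ hC hk hk0 hk1 hsupp hmod (hr.smul hw)
  have hv : ((N + 1 : ℕ) : ℝ)⁻¹ * ∑ i, ‖(z i).2‖ ≤
      1 / 2 + ((N + 1 : ℕ) : ℝ)⁻¹ * ∑ i, ‖(z i).2‖ ^ 2 / 2 := by
    have hn : ((N + 1 : ℕ) : ℝ)⁻¹ * ∑ _i : Fin (N + 1), (1 / 2 : ℝ) = 1 / 2 := by
      rw [Finset.sum_const, Finset.card_univ, Fintype.card_fin, nsmul_eq_mul, ← mul_assoc,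
        inv_mul_cancel₀ (by positivity), one_mul]
    rw [← hn, ← mul_add, ← Finset.sum_add_distrib]
    refine mul_le_mul_of_nonneg_left (Finset.sum_le_sum fun i _ => ?_) (by positivity)
    nlinarith [sq_nonneg (‖(z i).2‖ - 1), norm_nonneg (z i).2]
  have hK := kinetic_le z hk hk1 hr hw hϑ
  calc ‖empiricalMomentumField z χ - ∫ x, (χ x * r x) • w x‖
      = ‖empiricalMomentumField z χ - ∫ x, χ x • r x • w x‖ := by simp_rw [mul_smul]
    _ ≤ _ := h
    _ ≤ _ := add_le_add (mul_le_mul_of_nonneg_left (hv.trans (by linarith)) hω0)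
        (mul_le_mul_of_nonneg_left (integral_comp_le z hk hr hw hϑ).2.1 hC0)

/-- **Energy**: `|⟨E_N, χ⟩ − ∫ χ Ē| ≤ ω (|∫ Ē| + D) + ‖χ‖_∞ D`. -/
theorem abs_energy_dev_le (hχ : Continuous χ) (hC0 : 0 ≤ C) (hC : ∀ x, |χ x| ≤ C) (hk : Continuous k)
    (hk0 : ∀ y, 0 ≤ k y) (hk1 : ∫ y, k y = 1) (hsupp : ∀ x y, k (x - y) ≠ 0 → dist x y < ℓ₀)
    (hω0 : 0 ≤ ω) (hmod : ∀ x y, dist x y < ℓ₀ → |χ x - χ y| ≤ ω) (hr : Continuous r)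
    (hw : Continuous w) (hϑ : Continuous ϑ) :
    |empiricalEnergyField z χ - ∫ x, χ x * totalEnergyDensity (r x) (w x) (ϑ x)| ≤
      ω * (|∫ x, totalEnergyDensity (r x) (w x) (ϑ x)| +
          ∫ x, stateDist (mollState k z x) (consState (r x) (w x) (ϑ x))) +
        C * ∫ x, stateDist (mollState k z x) (consState (r x) (w x) (ϑ x)) := by
  have h := norm_field_dev_le z (A := fun χ => empiricalEnergyField z χ) (a := fun i => ‖(z i).2‖ ^ 2 / 2)
    (fun χ => by simp only [empiricalEnergyField_eq_sum, smul_eq_mul])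
    hχ hC hk hk0 hk1 hsupp hmod (continuous_totalEnergy hr hw hϑ)
  have he : ((N + 1 : ℕ) : ℝ)⁻¹ * ∑ i, ‖‖(z i).2‖ ^ 2 / 2‖ = ((N + 1 : ℕ) : ℝ)⁻¹ * ∑ i, ‖(z i).2‖ ^ 2 / 2 := by
    congr 1
    exact Finset.sum_congr rfl fun i _ => by rw [Real.norm_eq_abs, abs_of_nonneg (by positivity)]
  rw [he] at h
  exact h.trans (add_le_add (mul_le_mul_of_nonneg_left (kinetic_le z hk hk1 hr hw hϑ) hω0)
    (mul_le_mul_of_nonneg_left (integral_comp_le z hk hr hw hϑ).2.2 hC0))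

end Deviations

/-! ### Measurability of the field-distance observable and the Markov step -/

/-- `fieldDistObs` is measurable in the initial configuration (continuous kernel and macroscopic
slices: finite sums, `StronglyMeasurable.integral_prod_right'`; measurable flow). -/
theorem measurable_fieldDistObs {σ : ℝ} {ρ θ : ℝ → T3 → ℝ} {u : ℝ → T3 → V3}
    (Φ : HardSphereFlow (Literature.Analysis.FluidPDE.Torus.geometry (Fin 3)) (hsDiameter σ N) (N + 1))
    {k : T3 → ℝ} {t : ℝ} (hk : Continuous k) (hρ : Continuous (ρ t)) (hu : Continuous (u t))
    (hθ : Continuous (θ t)) : Measurable (fieldDistObs σ ρ u θ N Φ k t) := by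
  have hK : Measurable fun q : T3 × T3 => k (q.1 - q.2) :=
    (hk.comp (continuous_fst.sub continuous_snd)).measurable
  have hr : Measurable fun p : Config (N + 1) (Fin 3) T3 × T3 => ρ t p.2 := hρ.measurable.comp measurable_snd
  have hw : Measurable fun p : Config (N + 1) (Fin 3) T3 × T3 => u t p.2 := hu.measurable.comp measurable_snd
  have hE : Measurable fun p : Config (N + 1) (Fin 3) T3 × T3 =>
      totalEnergyDensity (ρ t p.2) (u t p.2) (θ t p.2) :=
    (continuous_totalEnergy hρ hu hθ).measurable.comp measurable_snd
  have hF : Measurable fun p : Config (N + 1) (Fin 3) T3 × T3 =>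
      stateDist (mollState k p.1 p.2) (consState (ρ t p.2) (u t p.2) (θ t p.2)) := by
    simp only [stateDist, mollState_fst, mollState_snd_fst, mollState_snd_snd, consState_fst,
      consState_snd_fst, consState_snd_snd]
    exact (((LGFS.measurable_empiricalDensityField_param (k := fun x y => k (x - y)) hK).sub hr).abs.add
      ((LGFS.measurable_empiricalMomentumField_param (k := fun x y => k (x - y)) hK).sub
        (hr.smul hw)).norm).add
      ((LGFS.measurable_empiricalEnergyField_param (k := fun x y => k (x - y)) hK).sub hE).abs
  exact (hF.stronglyMeasurable.integral_prod_right' (ν := volume)).measurable.comp (Φ.measurable_flow t)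

/-- **Markov step.** If on the events `E_N` every deviation bound `ω(1 + C_E + D) + C D` exceeds `δ`
(for every admissible kernel of radius `≤ ℓ₀`, `D = fieldDistObs`), with `0 < ω` and
`ω(1 + C_E) ≤ δ/2`, then `E_N ⊆ {D ≥ δ/(2(ω + C))}` and `P_N(E_N) → 0` under `FieldsCloseViaKernelsAt`. -/
theorem tendsto_measure_of_dev {σ : ℝ} {a₀ θ₀ : T3 → ℝ} {u₀ : T3 → V3}
    {Φ : (N : ℕ) → HardSphereFlow (Literature.Analysis.FluidPDE.Torus.geometry (Fin 3)) (hsDiameter σ N) (N + 1)}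
    {ρ θ : ℝ → T3 → ℝ} {u : ℝ → T3 → V3} {t : ℝ}
    (hρ : Continuous (ρ t)) (hu : Continuous (u t)) (hθ : Continuous (θ t))
    (hFC : FieldsCloseViaKernelsAt σ a₀ u₀ θ₀ Φ ρ u θ t)
    {E : (N : ℕ) → Set (Config (N + 1) (Fin 3) T3)} {δ ω CE C ℓ₀ : ℝ} (hδ : 0 < δ) (hC0 : 0 ≤ C)
    (hω0 : 0 < ω) (hωδ : ω * (1 + CE) ≤ δ / 2) (hℓ₀ : 0 < ℓ₀)
    (hE : ∀ ℓ, ℓ ≤ ℓ₀ → ∀ k, IsKernel ℓ k → ∀ N z, z ∈ E N →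
      δ < ω * (1 + CE + fieldDistObs σ ρ u θ N (Φ N) k t z) + C * fieldDistObs σ ρ u θ N (Φ N) k t z) :
    Tendsto (fun N => localGibbsLaw σ a₀ u₀ θ₀ N (Φ N) (E N)) atTop (𝓝 0) := by
  set c : ℝ := δ / (2 * (ω + C)) with hc
  have hc0 : 0 < c := by positivity
  rw [ENNReal.tendsto_nhds_zero]
  intro b hb
  rcases eq_or_ne b ⊤ with rfl | hbt
  · exact Eventually.of_forall fun N => le_top
  have hbpos : 0 < b.toReal := ENNReal.toReal_pos hb.ne' hbt
  obtain ⟨ℓ, -, hℓℓ₀, k, hk, hev⟩ := hFC (c * b.toReal) (by positivity) ℓ₀ hℓ₀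
  filter_upwards [hev] with N hN
  have hmeas : Measurable fun z => ENNReal.ofReal (fieldDistObs σ ρ u θ N (Φ N) k t z) :=
    (measurable_fieldDistObs (Φ N) hk.1 hρ hu hθ).ennreal_ofReal
  have hsub : E N ⊆ {z | ENNReal.ofReal c ≤ ENNReal.ofReal (fieldDistObs σ ρ u θ N (Φ N) k t z)} := by
    intro z hz
    have h := hE ℓ hℓℓ₀ k hk N z hz
    refine ENNReal.ofReal_le_ofReal ?_
    rw [hc, div_le_iff₀ (by positivity)]
    linarith
  have hc0' : ENNReal.ofReal c ≠ 0 := (ENNReal.ofReal_pos.2 hc0).ne'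
  calc localGibbsLaw σ a₀ u₀ θ₀ N (Φ N) (E N)
      ≤ localGibbsLaw σ a₀ u₀ θ₀ N (Φ N)
          {z | ENNReal.ofReal c ≤ ENNReal.ofReal (fieldDistObs σ ρ u θ N (Φ N) k t z)} := measure_mono hsub
    _ ≤ ENNReal.ofReal (c * b.toReal) / ENNReal.ofReal c := by
        rw [ENNReal.le_div_iff_mul_le (Or.inl hc0') (Or.inl ENNReal.ofReal_ne_top), mul_comm]
        exact (mul_meas_ge_le_lintegral₀ hmeas.aemeasurable _).trans hN
    _ = ENNReal.ofReal b.toReal := by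
        rw [← ENNReal.ofReal_div_of_pos hc0, mul_div_cancel_left₀ _ hc0.ne']
    _ ≤ b := ENNReal.ofReal_toReal_le

end FieldsCloseTendsto

open FieldsCloseTendsto in
/-- **S3c (M).** Fields close in mean along kernels of vanishing radius ⇒ `TendstoHydroFieldsAt`. -/
theorem stub_fieldsCloseTendsto : Sig.stub_fieldsCloseTendsto := by
  intro σ a₀ θ₀ u₀ Φ ρ θ u t hρ hu hθ hFC χ hχ δ hδ
  obtain ⟨C, hC0, hC⟩ := exists_forall_abs_le_of_continuous hχ
  have hE0 := abs_nonneg (∫ x, totalEnergyDensity (ρ t x) (u t x) (θ t x))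
  obtain ⟨ω, hω0, hωδ⟩ : ∃ ω : ℝ, 0 < ω ∧ ω * (1 + |∫ x, totalEnergyDensity (ρ t x) (u t x) (θ t x)|) ≤ δ / 2 :=
    ⟨δ / (2 * (1 + |∫ x, totalEnergyDensity (ρ t x) (u t x) (θ t x)|)), by positivity,
      le_of_eq (by rw [div_mul_eq_mul_div, mul_div_mul_right _ _ (by positivity)])⟩
  obtain ⟨ℓ₀, hℓ₀, hUC⟩ :=
    Metric.uniformContinuous_iff.1 (CompactSpace.uniformContinuous_of_continuous hχ) ω hω0
  have hmod : ∀ x y, dist x y < ℓ₀ → |χ x - χ y| ≤ ω := fun x y hxy => by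
    simpa only [Real.dist_eq] using (hUC hxy).le
  have hsupp : ∀ ℓ, ℓ ≤ ℓ₀ → ∀ k, IsKernel ℓ k → ∀ x y : T3, k (x - y) ≠ 0 → dist x y < ℓ₀ := by
    intro ℓ hℓ k hk x y hxy
    have h2 : ‖x - y - 0‖ ≤ Literature.Analysis.FluidPDE.Torus.euclidDist (x - y) 0 :=
      Torus.norm_sub_le_euclidDist_holds (x - y) 0
    rw [sub_zero, ← dist_eq_norm] at h2
    exact h2.trans_lt ((hk.2.2.2 _ hxy).trans_le hℓ)
  have hDn : ∀ (k : T3 → ℝ) N (z : Config (N + 1) (Fin 3) T3), 0 ≤ fieldDistObs σ ρ u θ N (Φ N) k t z :=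
    fun k N z => integral_nonneg fun x => stateDist_nonneg _ _
  refine ⟨?_, ?_, ?_⟩
  · refine tendsto_measure_of_dev hρ hu hθ hFC hδ hC0 hω0 hωδ hℓ₀
      (E := fun N => {z | δ < |empiricalDensityField ((Φ N).flow t z) χ - ∫ x, χ x * ρ t x|})
      fun ℓ hℓ k hk N z hz => ?_
    have hb := abs_density_dev_le ((Φ N).flow t z) hχ hC0 hC hk.1 hk.2.1 hk.2.2.1 (hsupp ℓ hℓ k hk)
      hmod hρ hu hθ
    have hD := hDn k N z
    unfold fieldDistObs at hD ⊢
    exact lt_of_lt_of_le hz (hb.trans (by nlinarith [mul_nonneg hω0.le hE0, mul_nonneg hω0.le hD]))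
  · refine tendsto_measure_of_dev hρ hu hθ hFC hδ hC0 hω0 hωδ hℓ₀
      (E := fun N => {z | δ < ‖empiricalMomentumField ((Φ N).flow t z) χ - ∫ x, (χ x * ρ t x) • u t x‖})
      fun ℓ hℓ k hk N z hz => ?_
    have hb := norm_momentum_dev_le ((Φ N).flow t z) hχ hC0 hC hk.1 hk.2.1 hk.2.2.1 (hsupp ℓ hℓ k hk)
      hω0.le hmod hρ hu hθ
    unfold fieldDistObs
    exact lt_of_lt_of_le hz (hb.trans (by nlinarith))
  · refine tendsto_measure_of_dev hρ hu hθ hFC hδ hC0 hω0 hωδ hℓ₀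
      (E := fun N => {z | δ < |empiricalEnergyField ((Φ N).flow t z) χ -
        ∫ x, χ x * totalEnergyDensity (ρ t x) (u t x) (θ t x)|})
      fun ℓ hℓ k hk N z hz => ?_
    have hb := abs_energy_dev_le ((Φ N).flow t z) hχ hC0 hC hk.1 hk.2.1 hk.2.2.1 (hsupp ℓ hℓ k hk)
      hω0.le hmod hρ hu hθ
    unfold fieldDistObs
    exact lt_of_lt_of_le hz (hb.trans (by nlinarith))

end Summit.AtomisticToContinuum.HydrodynamicLimit.Theorems.AWS

end
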